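import Mathlib
import HarnessLib
import Summits.HubbardSuperconductivity.HubbardSuperconductivity.Theorems.KLProgrammeKLRegimeVolumeLimitV11HmisCovOfTowerP
import Summits.HubbardSuperconductivity.HubbardSuperconductivity.Theorems.KLProgrammeKLRegimeEngineTowerParityUnits

/-!
# Route `KLProgramme` — crux K3, VL child (stmt-HubbardSuperconductivity-20440): the atom `HE1` REDUCED TO THE ENGINE'S TOP-FRAME TOWER EXPORT
# (located finding «HE1-FRAME», seat p3 g19, pen (R259) «read HE1 against the tree»)

After `stub_vl_towerDataW_WF2_of_HE1` (p3 g19) the window-key data stub reads HE1 ⊕ producer.  This file records, in Lean, what HE1 is and is not: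

* §1 **`towerP_klPredsV17F2_frame_irrel`** (`Iff.rfl`) — the tower hypothesis `TowerP klPredsV17F2 G P Q R β U μ K Lstar Mstar` does NOT depend on its frame
  argument: every slot of `klPredsV17F2` ignores `K` (`engine := EngineBoundsAtV17F2 … n` at the FLOW frame `K_n = klFlowFrameU … n`, etc.).  HE1 speaks of
  `𝒱_{j+1}[K_L]`, `K_L = K_{n_β+1}` = `klEffectiveAction … (klFlowFrameU L M β U μ (n_β+1)) klE0 (j+1)` = `effAction C^{K_L}_{>Λ_{j+1}} V_{K_L}` — for `j < n_β` a different
  Grassmann element from the flow-frame action `𝒱_{j+1}[K_{j+1}]` that `KernelNormsV4 … (K_{j+1}) (j+1)` measures (different cutoff band `e_{K}` and counterterm);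
  so no theorem `TowerP klPredsV17F2 … → HE1` can use the tower beyond the flow-frame data, and the tree has no frame-transport of effective actions at fixed scale.
* §2 **`klWtPinnedSumAt_klEffectiveAction_eq_zero_of_odd`** — odd degrees of the rate-decoupled read-out of `𝒱_n[K]` vanish at every family / rate / frame
  (E1's parity `map_sectorAnalysis_klEffectiveAction_mem_evenPart`).
* §3 **`he1_of_topFrameTowerEven`** — HE1 (the exact binder of `stub_vl_towerDataW_WF2_of_HE1`) follows from the EVEN-DEGREE, `S₀`-free statement
  `HtopEven`: beyond thresholds, `Z_{k+1}[K_L] ≠ 0` (`k ≤ n_β`) and `klWtPinnedSumAt … K_L j j (2p) (𝒱_{j+1}[K_L]) q w ≤ C₀·klWtBudget P Q U (j+1) (2p)` (`j ≤ n_β`,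
  `p ≥ 1`) — i.e. EXACTLY the measured weighted sizes `μ (j+1) (2p)` of E1's one-shot blocked tower (…EngineTowerModelDefs, `klTowerMeasWtAt`, block length `1`)
  AT THE TOP FRAME `K_{n_β+1}` in law units (`law_mul_units_le_klWtBudget`), plus the units `Z ≠ 0` of its steps.  This is what the ENGINE child's stub (b)/(ℓ)
  computes on its way to `EngineBoundsAtV17F2 … (n_β+1)` but does not EXPORT: HE1 = an export clause of the engine at its last scale (text), or an
  engine-lane item with the same proof; it is not a consequence of the registered per-scale slots.

Proofs only; no definition; nothing asserts HE1, HtopEven, the producer, any stub, K3, VL or superconductivity.  [cite: BenfattoGiulianiMastropietro2006, §2.8 (2.83), §3]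
-/

noncomputable section

namespace Summit.HubbardSuperconductivity.HubbardSuperconductivity.Theorems.TwoVolumeSource

set_option linter.dupNamespace false -- summit = problem name (single-conjunct summit), D-0017

open Finset Filter Topology Literature.MathematicalPhysics.QuantumLattice GrassmannAlgebra Literature.Probability.LatticeModels
  Literature.Probability.LatticeModels.BattleFederbush
open Summit.HubbardSuperconductivity.HubbardSuperconductivity.Theorems.TwoPointAssembly
open Summit.HubbardSuperconductivity.HubbardSuperconductivity.Theorems.KLRegimeSplit
open Summit.HubbardSuperconductivity.HubbardSuperconductivity.Theorems.KLProgrammeLegKernels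
open Summit.HubbardSuperconductivity.HubbardSuperconductivity.Theorems.EngineV8
open Summit.HubbardSuperconductivity.HubbardSuperconductivity.Theorems.TwoVolumeDefect
open Summit.HubbardSuperconductivity.HubbardSuperconductivity.Theorems.TorusFourierL2

/-! ## §1 The tower hypothesis is frame-blind -/

/-- **`TowerP klPredsV17F2` does not depend on its frame argument** (every slot of `klPredsV17F2` ignores `K`). [folklore] -/
theorem towerP_klPredsV17F2_frame_irrel (G : GeoConsts) (P : SplitConsts) (Q : EngConsts) (R : RenConsts) (β U μ : ℝ) (K K' : TrigPolyC4v)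
    (Lstar : ℕ) (Mstar : ℕ → ℕ) :
    TowerP klPredsV17F2 G P Q R β U μ K Lstar Mstar ↔ TowerP klPredsV17F2 G P Q R β U μ K' Lstar Mstar := Iff.rfl

/-! ## §2 Parity of the rate-decoupled read-out -/

/-- **Odd degrees of the rate-decoupled read-out of `𝒱_n[K]` vanish** at every family `F_J`, rate `j`, frame `K` (`β ≠ 0`).
[cite: BenfattoGiulianiMastropietro2006, §2.3 (2.17)–(2.23)] -/
theorem klWtPinnedSumAt_klEffectiveAction_eq_zero_of_odd {L M : ℕ} [NeZero L] [NeZero M] {β : ℝ} (hβ : β ≠ 0) (U μ : ℝ) (K : TrigPolyC4v)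
    (J j n : ℕ) {m : ℕ} (hm : Odd m) (q : Fin m) (w : SpaceTimeIdx L M × SectorLeg (sectorCount J)) :
    klWtPinnedSumAt L M β μ K J j m (klEffectiveAction L M β U μ K klE0 n) q w = 0 := by
  rw [klWtPinnedSumAt]
  refine mul_eq_zero_of_right _ (sum_eq_zero fun X _ => ?_)
  rw [kernel_eq_zero_of_mem_evenPart_of_odd ℂ (map_sectorAnalysis_klEffectiveAction_mem_evenPart hβ U μ K klE0 J n) hm X, norm_zero, mul_zero]

/-! ## §3 HE1 from the even-degree top-frame tower export -/

set_option maxHeartbeats 1600000 in -- long binders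
/-- **HE1 ⟸ the even-degree, `S₀`-free top-frame tower statement `HtopEven`** (see the module docstring): `S₀ j m := C₀·klWtBudget P Q U (j+1) m` at even
`m`, `0` at odd `m` (parity, §2); degree `0` has no pin. [cite: BenfattoGiulianiMastropietro2006, §2.8 (2.83)] -/
theorem he1_of_topFrameTowerEven
    (HtopEven : ∀ (G : GeoConsts) (P : SplitConsts) (Q : EngConsts) (R : RenConsts), G.WF → P.WF → Q.WF → R.WF2 →
      ∃ C₀ : ℝ, 0 ≤ C₀ ∧
        ∃ c₇ : ℝ, 0 < c₇ ∧ ∀ c : ℝ, 0 < c → c ≤ c₇ → ∃ U₇ : ℝ, 0 < U₇ ∧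
          ∀ μ ∈ klWindowC, ∀ U : ℝ, 0 < U → U ≤ U₇ → ∀ β : ℝ, klBetaMin ≤ β → β ≤ Real.exp (c / U ^ 2) →
            ∀ (K : TrigPolyC4v) (Lstar : ℕ) (Mstar : ℕ → ℕ), TowerP klPredsV17F2 G P Q R β U μ K Lstar Mstar →
            ∃ L₂ : ℕ, ∃ M₂ : ℕ → ℕ, ∀ (L M : ℕ) [NeZero L] [NeZero M], L₂ ≤ L → M₂ L ≤ M →
              (∀ k, k ≤ nScales β → hubbardEffPartitionFnCT L M β U μ 0 (klFlowFrameU L M β U μ (nScales β + 1)) (klScale klE0 (k + 1)) ≠ 0) ∧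
              (∀ j, j ≤ nScales β → ∀ p : ℕ, 1 ≤ p → ∀ (q : Fin (2 * p)) (w : SpaceTimeIdx L M × SectorLeg (sectorCount j)),
                klWtPinnedSumAt L M β μ (klFlowFrameU L M β U μ (nScales β + 1)) j j (2 * p)
                  (klEffectiveAction L M β U μ (klFlowFrameU L M β U μ (nScales β + 1)) klE0 (j + 1)) q w ≤ C₀ * klWtBudget P Q U (j + 1) (2 * p)))
    (G : GeoConsts) (P : SplitConsts) (Q : EngConsts) (R : RenConsts) (hG : G.WF) (hP : P.WF) (hQ : Q.WF) (hR2 : R.WF2) :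
  ∃ C₀ : ℝ, 0 ≤ C₀ ∧
    ∃ c₇ : ℝ, 0 < c₇ ∧ ∀ c : ℝ, 0 < c → c ≤ c₇ → ∃ U₇ : ℝ, 0 < U₇ ∧
      ∀ μ ∈ klWindowC, ∀ U : ℝ, 0 < U → U ≤ U₇ → ∀ β : ℝ, klBetaMin ≤ β → β ≤ Real.exp (c / U ^ 2) →
        ∀ (K : TrigPolyC4v) (Lstar : ℕ) (Mstar : ℕ → ℕ), TowerP klPredsV17F2 G P Q R β U μ K Lstar Mstar →
        ∃ S₀ : ℕ → ℕ → ℝ, (∀ j m, 0 ≤ S₀ j m) ∧ (∀ j, j ≤ nScales β → ∀ m, 1 ≤ m → S₀ j (2 * m) ≤ C₀ * klWtBudget P Q U (j + 1) (2 * m)) ∧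
        ∃ L₂ : ℕ, ∃ M₂ : ℕ → ℕ, ∀ (L M : ℕ) [NeZero L] [NeZero M], L₂ ≤ L → M₂ L ≤ M →
          (∀ k, k ≤ nScales β → hubbardEffPartitionFnCT L M β U μ 0 (klFlowFrameU L M β U μ (nScales β + 1)) (klScale klE0 (k + 1)) ≠ 0) ∧
          (∀ j, j ≤ nScales β → ∀ (m : ℕ) (q : Fin m) (w : SpaceTimeIdx L M × SectorLeg (sectorCount j)),
            klWtPinnedSumAt L M β μ (klFlowFrameU L M β U μ (nScales β + 1)) j j m (klEffectiveAction L M β U μ (klFlowFrameU L M β U μ (nScales β + 1)) klE0 (j + 1)) q w ≤ S₀ j m) := by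
  classical
  obtain ⟨C₀, hC₀, c₇, hc₇, h⟩ := HtopEven G P Q R hG hP hQ hR2
  have hKl : 0 ≤ P.Klam := le_trans zero_le_one hP.1
  have hCE : 0 ≤ Q.CE := hQ.1
  refine ⟨C₀, hC₀, c₇, hc₇, fun c hc hcc => ?_⟩
  obtain ⟨U₇, hU₇, h'⟩ := h c hc hcc
  refine ⟨U₇, hU₇, fun μ hμ U hU hUU β hβmin hβc K Lstar Mstar hT => ?_⟩
  have hβ0 : β ≠ 0 := (KLRegimeSplit.pos_of_klBetaMin_le hβmin).ne'
  obtain ⟨L₂, M₂, hI⟩ := h' μ hμ U hU hUU β hβmin hβc K Lstar Mstar hT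
  refine ⟨fun j m => if Even m then C₀ * klWtBudget P Q U (j + 1) m else 0, fun j m => ?_, fun j _ m _ => ?_, L₂, M₂,
    fun L M _ _ hL hM => ?_⟩
  · -- signs
    show 0 ≤ (if Even m then C₀ * klWtBudget P Q U (j + 1) m else 0)
    split_ifs
    · exact mul_nonneg hC₀ (klWtBudget_nonneg hCE hKl U (j + 1) m)
    · exact le_rfl
  · -- the law in the even degrees (an equality)
    show (if Even (2 * m) then C₀ * klWtBudget P Q U (j + 1) (2 * m) else 0) ≤ C₀ * klWtBudget P Q U (j + 1) (2 * m)
    rw [if_pos (even_two_mul m)]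
  · obtain ⟨hZ, hread⟩ := hI L M hL hM
    refine ⟨hZ, fun j hj m q w => ?_⟩
    show _ ≤ (if Even m then C₀ * klWtBudget P Q U (j + 1) m else 0)
    rcases Nat.even_or_odd m with he | ho
    · rw [if_pos he]
      obtain ⟨p, hp⟩ := he
      rcases Nat.eq_zero_or_pos p with hp0 | hp0
      · -- degree `0`: no pin
        subst hp; rw [hp0] at q; exact q.elim0
      · have hm2 : m = 2 * p := by rw [hp]; ring
        subst hm2
        exact hread j hj p hp0 q w
    · rw [if_neg (Nat.not_even_iff_odd.2 ho), klWtPinnedSumAt_klEffectiveAction_eq_zero_of_odd hβ0 U μ _ j j (j + 1) ho q w]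

end Summit.HubbardSuperconductivity.HubbardSuperconductivity.Theorems.TwoVolumeSource

end
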